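import Mathlib

/-!
# SoloBlindFunctorialLock — every non-abelian functorial transfer of a regular algebraic cusp
# form over a field `K` with `[K : K_cm] = m` has a Hodge–Tate weight of multiplicity `≥ m`

Solo seat `solo-Langlands-blind`, session 11.  This is the combinatorial heart of the
PARALLEL-WEIGHT LOCK in its functorial form (HOME/paper/paper.md §3, T0(4)); it generalises the
automorphic-induction computation of `SoloBlindInducedMultiplicity` (T0(3): the transfer
`AI_{K/ℚ}`, where the bound `m` is attained) to EVERY algebraic representation of the `L`-group.

## The arithmetic statement (T0(4)) and its dictionary

Let `K` be a number field, `K_cm ⊆ K` its maximal totally-real-or-CM subfield, `m := [K : K_cm]`,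
`F₀ ⊆ K_cm` any subfield, `π` a cuspidal regular algebraic representation of `GL_n(𝔸_K)`
(`n ≥ 2`) and `r : ᴸ(Res_{K/F₀} GL_n) → GL_N(ℂ)` an algebraic representation of the `L`-group
whose restriction to the neutral component `GL_n(ℂ)^E`, `E := Hom_{F₀}(K, ℂ)`, is not a sum of
characters.  Then at every archimedean place of `F₀` the multiset of holomorphic exponents
(equivalently: of Hodge–Tate weights of `r ∘ ρ_{π,ι}` at every embedding, if a Galois
representation `ρ_{π,ι}` is attached to `π`) of the archimedean transfer `r_*(π_∞)` contains an
exponent of multiplicity `≥ m`.  In particular for `m ≥ 3` (every field containing a complex cubic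
field, `SoloBlindCubicField`; every field of prime degree `p ≥ 3` with a real and a complex place,
where `m = p`) NO functorial transfer of `π` to any `GL_N` over any totally real or CM field is
regular (Shimura-variety étale cohomology: Harris–Lan–Taylor–Thorne, Scholze) or weakly regular in
the sense of Fakhruddin–Pilloni (coherent cohomology / limits of discrete series: every exponent of
multiplicity `≤ 2`; Boxer–Calegari–Gee–Pilloni §1.4.1 record the same wall for abelian threefolds:
"no Hodge–Tate weight can occur with multiplicity bigger than 2" in any cohomology of the relevant
Shimura varieties).  The bound is sharp: `r = Ind` (automorphic induction `AI_{K/K_cm}`) has every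
exponent with multiplicity exactly `m ·`(its multiplicity in `π`).

Dictionary to the theorem `functorialLock` below (all data at ONE archimedean place of `F₀`, i.e.
one embedding `F₀ → ℂ`, extended to an embedding of the Galois closure `K^g` of `K/F₀`):
* `E` = `Hom_{F₀}(K, ℂ)`, the index set of the tensor factors of `ᴸ(Res_{K/F₀} GL_n)⁰ = GL_n(ℂ)^E`;
* `Γ` = `Gal(K^g / K_cm^g)` (`K_cm^g` the Galois closure of `K_cm` over `F₀`, again totally real
  or CM), acting on `E` by composition; its orbits are the fibres of `E → Hom_{F₀}(K_cm, ℂ)` and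
  have exactly `m` elements (`K ∩ K_cm^g = K_cm` because subfields of CM-or-totally-real fields are
  CM or totally real, and `K_cm^g/K_cm` is Galois, so `K`, `K_cm^g` are linearly disjoint over
  `K_cm`) — this discharges `hm` with `m = [K : K_cm]`;
* `Λ` = dominant weights of `GL_n`; `S` = the irreducible constituents `⊠_{x ∈ E} V_{τ s x}` of
  `r|_{GL_n(ℂ)^E}` counted with multiplicity, `τ : S → E → Λ`; since `r` is a representation of
  the whole `L`-group, conjugation by (a lift of) `γ ∈ Γ` permutes the tensor factors along
  `x ↦ γx` and fixes the isomorphism class of `r|_{GL_n^E}`, so the family of constituents is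
  stable under `τ s ↦ τ s ∘ γ` — hypothesis `hτ`;
* `W l x ∈ ℕ[X]` = the generating polynomial `∑_w (mult. of w) X^w` of the exponents of
  `V_l ∘ (π_∞ at the embedding x)` (after one global shift making all exponents `≥ 0`, which
  changes no multiplicity): it depends on `x` only through the exponent multiset `A_x(π)` of `π` at
  `x`, and `A_{γx}(π) = A_x(π)` for `γ ∈ Γ` is the CM-DESCENT OF INFINITY TYPES (Clozel purity +
  Patrikis, kernel `SoloBlind.map_a_eq_of_isRegularAlgebraic` in `SoloBlindCMDescent`, granted the
  tree's named fact `Clozel1990_regularAlgebraic`) — hypothesis `hWinv`; `W l x ≠ 0` since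
  `dim V_l ≥ 1` — hypothesis `hW0`;
* non-abelian witness: some constituent `s₀` has at some position `x₀` a factor `V_{τ s₀ x₀}` of
  dimension `≥ 2`; since `π` is REGULAR (the `n` exponents at `x₀` are distinct) two weights of
  `V_{τ s₀ x₀}` differing by a root pair to distinct exponents, so `W (τ s₀ x₀) x₀` has two distinct
  monomials `X^u`, `X^v` — hypotheses `hu`, `hv`, `huv`;
* conclusion: the generating polynomial of the exponents of `r_*(π_∞)` at the chosen place,
  restricted to the neutral component, is `∑_s ∏_x W (τ s x) x`, and it has a coefficient `≥ m`.
(The same count applies verbatim to Arthur parameters `⊕_j (r_j ∘ φ_π) ⊠ Sym^{d_j}`: multiplying by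
the multiplicity-free progression of `Sym^{d_j}` and adding terms cannot lower a coefficient,
`coeff_mul_ge`.)

## The combinatorial theorem and its proof

`functorialLock`: a finite group `Γ` acts on a finite set `E`; `W : Λ → E → ℕ[X]` is nonvanishing
and `Γ`-invariant in `E`; `τ : S → E → Λ` is a finite `Γ`-stable family; the `Γ`-orbit of `x₀`
has `≥ m` elements; `W (τ s₀ x₀) x₀` has two distinct monomials.  Then some coefficient of
`∑_s ∏_x W (τ s x) x` is `≥ m`.  Proof: let `t := τ s₀`, `O := {t ∘ γ}` its orbit (`k` elements,
all occurring among the `τ s`, all with the same product polynomial `P` by invariance of `W`).  For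
`t' = t ∘ γ⁻¹ ∈ O` let `B(t') := {γ x₀ : t ∘ γ⁻¹ = t'}`; on `B(t')` the tuple `t'` takes the value
`t x₀` and `W (t x₀) · = W (t x₀) x₀ =: p₀`, and `⋃_{t' ∈ O} B(t') ⊇ Γx₀`, so some `B(t₁)` has
`b ≥ m / k` elements.  Then `P = p₀^b · R` and the coefficient of `p₀^b` at `X^{(b-1)u+v}` is
`≥ b` (`succ_le_coeff_pow`), so `P` has a coefficient `≥ b`, and the `k` members of `O` contribute
`≥ k b ≥ m` to the same coefficient of the total.  Everything is over `ℕ[X] = Polynomial ℕ` with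
Mathlib's `coeff_mul` (sum over the antidiagonal); no automorphic input is formalised here — the
dictionary above says exactly which published theorem discharges which hypothesis.

[cite: Clozel1990, Thm. 3.13 and Lemme 4.9] [cite: Patrikis2019, Prop. 2.4.7, Rem. 2.4.8 (1) and
§3.2 (arXiv:1207.6724 p. 24–25)] [cite: FakhruddinPilloni2021, §9.1 (weakly regular)]
[cite: BoxerEtAl2021, §1.4.1 (curves of genus ≥ 3: multiplicity ≤ 2 in every cohomology of the
Shimura variety)] [cite: BuzzardGeeLMS2014, §2–3 (L-groups, L- and C-algebraicity, Hodge–Tate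
weights vs. infinity types)]
-/

namespace Summit.Langlands.Langlands.Theorems.SoloBlind

open Polynomial Finset

/-! ### Coefficient lower bounds in `ℕ[X]` -/

section Coeff

/-- One term of the Cauchy product bounds a coefficient of a product from below. -/
theorem coeff_mul_ge (p q : ℕ[X]) (u v : ℕ) :
    p.coeff u * q.coeff v ≤ (p * q).coeff (u + v) := by
  rw [coeff_mul]
  have hmem : (u, v) ∈ antidiagonal (u + v) := by simp
  exact Finset.single_le_sum (f := fun x : ℕ × ℕ => p.coeff x.1 * q.coeff x.2)
    (fun _ _ => Nat.zero_le _) hmem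

/-- Two distinct terms of the Cauchy product bound a coefficient of a product from below. -/
theorem coeff_mul_ge_two (p q : ℕ[X]) {u v u' v' n : ℕ} (huu' : u ≠ u')
    (h : u + v = n) (h' : u' + v' = n) :
    p.coeff u * q.coeff v + p.coeff u' * q.coeff v' ≤ (p * q).coeff n := by
  rw [coeff_mul]
  have hne : (u, v) ≠ (u', v') := fun e => huu' (congrArg Prod.fst e)
  have hsub : ({(u, v), (u', v')} : Finset (ℕ × ℕ)) ⊆ antidiagonal n := by
    intro x hx
    simp only [Finset.mem_insert, Finset.mem_singleton] at hx
    rcases hx with rfl | rfl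
    · simpa using h
    · simpa using h'
  calc p.coeff u * q.coeff v + p.coeff u' * q.coeff v'
      = ∑ x ∈ ({(u, v), (u', v')} : Finset (ℕ × ℕ)), p.coeff x.1 * q.coeff x.2 := by
        rw [Finset.sum_pair hne]
    _ ≤ ∑ x ∈ antidiagonal n, p.coeff x.1 * q.coeff x.2 := Finset.sum_le_sum_of_subset hsub

/-- `(coeff_u p)^n ≤ coeff_{n u} (p ^ n)`. -/
theorem coeff_pow_ge (p : ℕ[X]) (u : ℕ) : ∀ n : ℕ, p.coeff u ^ n ≤ (p ^ n).coeff (n * u)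
  | 0 => by simp
  | n + 1 => by
    rw [pow_succ, pow_succ, Nat.succ_mul]
    exact le_trans (Nat.mul_le_mul_right _ (coeff_pow_ge p u n)) (coeff_mul_ge _ _ _ _)

/-- The key count: if `X^u` and `X^v` (`u ≠ v`) both occur in `p`, then `X^{b u + v}` occurs in
`p ^ (b + 1)` with coefficient at least `b + 1` (choose which of the `b + 1` factors carries `v`). -/
theorem succ_le_coeff_pow (p : ℕ[X]) {u v : ℕ} (huv : u ≠ v) (hu : 1 ≤ p.coeff u)
    (hv : 1 ≤ p.coeff v) : ∀ b : ℕ, b + 1 ≤ (p ^ (b + 1)).coeff (b * u + v)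
  | 0 => by simpa using hv
  | b + 1 => by
    have ih := succ_le_coeff_pow p huv hu hv b
    have h1 : 1 ≤ (p ^ (b + 1)).coeff ((b + 1) * u) :=
      le_trans (Nat.one_le_pow _ _ hu) (coeff_pow_ge p u (b + 1))
    have h2 := coeff_mul_ge_two p (p ^ (b + 1)) (u := u) (v := b * u + v) (u' := v)
      (v' := (b + 1) * u) (n := (b + 1) * u + v) huv (by ring) (by ring)
    have h3 := Nat.mul_le_mul hu ih
    have h4 := Nat.mul_le_mul hv h1
    rw [pow_succ']
    calc b + 1 + 1 ≤ p.coeff u * (p ^ (b + 1)).coeff (b * u + v)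
          + p.coeff v * (p ^ (b + 1)).coeff ((b + 1) * u) := by linarith
      _ ≤ (p * p ^ (b + 1)).coeff ((b + 1) * u + v) := h2

/-- A product of coefficients bounds the corresponding coefficient of the product. -/
theorem prod_coeff_le_coeff_prod {ι : Type*} (s : Finset ι) (f : ι → ℕ[X]) (e : ι → ℕ) :
    ∏ i ∈ s, (f i).coeff (e i) ≤ (∏ i ∈ s, f i).coeff (∑ i ∈ s, e i) := by
  classical
  induction s using Finset.induction_on with
  | empty => simp
  | @insert a s ha ih =>
    rw [Finset.prod_insert ha, Finset.prod_insert ha, Finset.sum_insert ha]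
    exact le_trans (Nat.mul_le_mul_left _ ih) (coeff_mul_ge _ _ _ _)

/-- A product of nonzero polynomials over `ℕ` has a coefficient `≥ 1` (at the sum of the degrees). -/
theorem one_le_coeff_prod_natDegree {ι : Type*} (s : Finset ι) (f : ι → ℕ[X])
    (hf : ∀ i ∈ s, f i ≠ 0) :
    1 ≤ (∏ i ∈ s, f i).coeff (∑ i ∈ s, (f i).natDegree) := by
  refine le_trans ?_ (prod_coeff_le_coeff_prod s f fun i => (f i).natDegree)
  exact Finset.prod_pos fun i hi => Nat.pos_of_ne_zero (by simpa using hf i hi)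

end Coeff

/-! ### The lock -/

section Lock

variable {Γ E Λ S : Type*} [Group Γ] [Fintype Γ] [MulAction Γ E] [Fintype E] [DecidableEq E]
  [DecidableEq Λ] [Fintype S] [DecidableEq S]

omit [Fintype Γ] [DecidableEq E] [DecidableEq Λ] [Fintype S] [DecidableEq S] in
/-- Invariance of `W` along the action makes the product polynomial of a tuple constant on its
`Γ`-orbit. -/
theorem prod_comp_smul (W : Λ → E → ℕ[X]) (hWinv : ∀ l (γ : Γ) (x : E), W l (γ • x) = W l x)
    (t : E → Λ) (γ : Γ) : ∏ x, W (t (γ • x)) x = ∏ x, W (t x) x := by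
  calc ∏ x, W (t (γ • x)) x = ∏ x, W (t (γ • x)) (γ • x) :=
        Finset.prod_congr rfl fun x _ => (hWinv _ γ x).symm
    _ = ∏ x, W (t x) x :=
        Fintype.prod_equiv (MulAction.toPerm γ) (fun x => W (t (γ • x)) (γ • x))
          (fun x => W (t x) x) (fun x => by simp)

/-- **The functorial lock** (combinatorial form; dictionary in the module docstring).  A finite
group `Γ` acts on the finite index set `E`; `W : Λ → E → ℕ[X]` is nonvanishing and `Γ`-invariant
in the second variable; `τ : S → E → Λ` is a finite `Γ`-stable family of tuples; the orbit of `x₀`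
has at least `m` elements; and the polynomial `W (τ s₀ x₀) x₀` has two distinct monomials.  Then
the total generating polynomial `∑_s ∏_x W (τ s x) x` has a coefficient `≥ m`. -/
theorem functorialLock (W : Λ → E → ℕ[X]) (hW0 : ∀ l x, W l x ≠ 0)
    (hWinv : ∀ l (γ : Γ) (x : E), W l (γ • x) = W l x)
    (τ : S → E → Λ) (hτ : ∀ (γ : Γ) (s : S), ∃ s', τ s' = fun x => τ s (γ • x))
    (s₀ : S) (x₀ : E) {u v : ℕ} (huv : u ≠ v)
    (hu : (W (τ s₀ x₀) x₀).coeff u ≠ 0) (hv : (W (τ s₀ x₀) x₀).coeff v ≠ 0)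
    {m : ℕ} (hm : m ≤ (univ.image fun γ : Γ => γ • x₀).card) :
    ∃ w : ℕ, m ≤ (∑ s, ∏ x, W (τ s x) x).coeff w := by
  classical
  -- the distinguished tuple, its value polynomial at `x₀`, its orbit
  set t : E → Λ := τ s₀ with ht
  set p₀ : ℕ[X] := W (t x₀) x₀ with hp₀
  have hu1 : 1 ≤ p₀.coeff u := Nat.one_le_iff_ne_zero.mpr hu
  have hv1 : 1 ≤ p₀.coeff v := Nat.one_le_iff_ne_zero.mpr hv
  set O : Finset (E → Λ) := univ.image fun γ : Γ => fun x => t (γ • x) with hO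
  -- the block of `x₀`-translates on which a member of the orbit is forced to take the value `t x₀`
  let B : (E → Λ) → Finset E := fun t' =>
    (univ.filter fun γ : Γ => (fun x => t (γ⁻¹ • x)) = t').image fun γ => γ • x₀
  -- (C1) the orbit of `x₀` is covered by the blocks
  have hcover : (univ.image fun γ : Γ => γ • x₀) ⊆ O.biUnion B := by
    intro x hx
    obtain ⟨γ, -, rfl⟩ := Finset.mem_image.mp hx
    refine Finset.mem_biUnion.mpr ⟨fun y => t (γ⁻¹ • y), ?_, ?_⟩
    · exact Finset.mem_image.mpr ⟨γ⁻¹, Finset.mem_univ _, rfl⟩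
    · exact Finset.mem_image.mpr ⟨γ, by simp, rfl⟩
  have hO_ne : O.Nonempty :=
    ⟨fun x => t ((1 : Γ) • x), Finset.mem_image.mpr ⟨1, Finset.mem_univ _, rfl⟩⟩
  obtain ⟨t₁, ht₁O, ht₁max⟩ := Finset.exists_max_image O (fun t' => (B t').card) hO_ne
  obtain ⟨b, hb⟩ : ∃ b, (B t₁).card = b := ⟨_, rfl⟩
  -- (C1') counting: m ≤ |O| · b
  have hmkb : m ≤ O.card * b := by
    calc m ≤ (univ.image fun γ : Γ => γ • x₀).card := hm
      _ ≤ (O.biUnion B).card := Finset.card_le_card hcover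
      _ ≤ ∑ t' ∈ O, (B t').card := Finset.card_biUnion_le
      _ ≤ ∑ t' ∈ O, b := Finset.sum_le_sum fun t' ht' => hb ▸ ht₁max t' ht'
      _ = O.card * b := by rw [Finset.sum_const, smul_eq_mul]
  -- (C2) on the block, `t₁` takes the value `t x₀` and the factor is `p₀`
  have hB : ∀ x ∈ B t₁, W (t₁ x) x = p₀ := by
    intro x hx
    obtain ⟨γ, hγ, rfl⟩ := Finset.mem_image.mp hx
    have hγ' : (fun y => t (γ⁻¹ • y)) = t₁ := (Finset.mem_filter.mp hγ).2
    rw [← hγ']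
    simp only [inv_smul_smul]
    rw [hp₀, hWinv]
  -- (C4) every member of the orbit has the same product polynomial as `t`
  have hP : ∀ t' ∈ O, ∏ x, W (t' x) x = ∏ x, W (t x) x := by
    intro t' ht'
    obtain ⟨γ, -, rfl⟩ := Finset.mem_image.mp ht'
    exact prod_comp_smul W hWinv t γ
  -- every member of the orbit is one of the `τ s`
  have hex : ∀ t' ∈ O, ∃ s', τ s' = t' := by
    intro t' ht'
    obtain ⟨γ, -, rfl⟩ := Finset.mem_image.mp ht'
    exact hτ γ s₀
  haveI : Nonempty S := ⟨s₀⟩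
  choose! sOf hsOf using hex
  have hinj : Set.InjOn sOf (O : Set (E → Λ)) := by
    intro t₁' h₁ t₂' h₂ heq
    calc t₁' = τ (sOf t₁') := (hsOf _ h₁).symm
      _ = τ (sOf t₂') := by rw [heq]
      _ = t₂' := hsOf _ h₂
  -- the case of an empty block is trivial
  rcases Nat.eq_zero_or_pos b with hb0 | hbpos
  · exact ⟨0, by rw [hb0, mul_zero] at hmkb; omega⟩
  obtain ⟨b', rfl⟩ : ∃ b', b = b' + 1 := ⟨b - 1, by omega⟩
  -- (C3) the product polynomial of `t₁` splits off `p₀ ^ (b'+1)` and has a coefficient `≥ b'+1`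
  set R : ℕ[X] := ∏ x ∈ (B t₁)ᶜ, W (t₁ x) x with hR
  set eR : ℕ := ∑ x ∈ (B t₁)ᶜ, (W (t₁ x) x).natDegree with heR
  have hsplit : ∏ x, W (t₁ x) x = p₀ ^ (b' + 1) * R := by
    rw [← Finset.prod_mul_prod_compl (B t₁) (fun x => W (t₁ x) x), ← hb]
    congr 1
    rw [Finset.prod_congr rfl hB, Finset.prod_const]
  have hR1 : 1 ≤ R.coeff eR :=
    one_le_coeff_prod_natDegree _ _ fun x _ => hW0 _ _
  set w : ℕ := b' * u + v + eR with hw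
  have hcoef : b' + 1 ≤ (∏ x, W (t x) x).coeff w := by
    rw [← hP t₁ ht₁O, hsplit, hw]
    calc b' + 1 = (b' + 1) * 1 := (mul_one _).symm
      _ ≤ (p₀ ^ (b' + 1)).coeff (b' * u + v) * R.coeff eR :=
          Nat.mul_le_mul (succ_le_coeff_pow p₀ huv hu1 hv1 b') hR1
      _ ≤ (p₀ ^ (b' + 1) * R).coeff (b' * u + v + eR) := coeff_mul_ge _ _ _ _
  -- (C5) the `|O|` members of the orbit contribute `|O| · (b'+1) ≥ m` to the coefficient of `X^w`
  refine ⟨w, ?_⟩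
  calc m ≤ O.card * (b' + 1) := hmkb
    _ ≤ O.card * (∏ x, W (t x) x).coeff w := Nat.mul_le_mul_left _ hcoef
    _ = ∑ t' ∈ O, (∏ x, W (t x) x).coeff w := by rw [Finset.sum_const, smul_eq_mul]
    _ = ∑ t' ∈ O, (∏ x, W (τ (sOf t') x) x).coeff w := by
        refine Finset.sum_congr rfl fun t' ht' => ?_
        rw [hsOf t' ht', hP t' ht']
    _ = ∑ s ∈ O.image sOf, (∏ x, W (τ s x) x).coeff w := by rw [Finset.sum_image hinj]
    _ ≤ ∑ s, (∏ x, W (τ s x) x).coeff w := Finset.sum_le_sum_of_subset (Finset.subset_univ _)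
    _ = (∑ s, ∏ x, W (τ s x) x).coeff w := (Polynomial.finsetSum_coeff _ _ _).symm

/-- The lock for a TRANSITIVE action (one `Γ`-orbit on `E`, e.g. `K` of prime degree with
`K_cm = ℚ`, where `E = Hom(K, ℂ)`): some coefficient is `≥ |E|`. -/
theorem functorialLock_of_transitive (W : Λ → E → ℕ[X]) (hW0 : ∀ l x, W l x ≠ 0)
    (hWinv : ∀ l (γ : Γ) (x : E), W l (γ • x) = W l x)
    (τ : S → E → Λ) (hτ : ∀ (γ : Γ) (s : S), ∃ s', τ s' = fun x => τ s (γ • x))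
    (s₀ : S) (x₀ : E) (htrans : ∀ x : E, ∃ γ : Γ, γ • x₀ = x) {u v : ℕ} (huv : u ≠ v)
    (hu : (W (τ s₀ x₀) x₀).coeff u ≠ 0) (hv : (W (τ s₀ x₀) x₀).coeff v ≠ 0) :
    ∃ w : ℕ, Fintype.card E ≤ (∑ s, ∏ x, W (τ s x) x).coeff w := by
  refine functorialLock W hW0 hWinv τ hτ s₀ x₀ huv hu hv (le_of_eq ?_)
  have h : (univ.image fun γ : Γ => γ • x₀) = univ :=
    Finset.eq_univ_iff_forall.mpr fun x => by
      obtain ⟨γ, hγ⟩ := htrans x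
      exact Finset.mem_image.mpr ⟨γ, Finset.mem_univ _, hγ⟩
  rw [h, Finset.card_univ]

/-- Reading for `m ≥ 3` (`[K : K_cm] ≥ 3`, e.g. every field containing a complex cubic field):
the transferred type is not WEAKLY REGULAR — it is false that every exponent has multiplicity
`≤ 2` — and a fortiori not regular. -/
theorem functorialLock_not_coeff_le_two (W : Λ → E → ℕ[X]) (hW0 : ∀ l x, W l x ≠ 0)
    (hWinv : ∀ l (γ : Γ) (x : E), W l (γ • x) = W l x)
    (τ : S → E → Λ) (hτ : ∀ (γ : Γ) (s : S), ∃ s', τ s' = fun x => τ s (γ • x))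
    (s₀ : S) (x₀ : E) {u v : ℕ} (huv : u ≠ v)
    (hu : (W (τ s₀ x₀) x₀).coeff u ≠ 0) (hv : (W (τ s₀ x₀) x₀).coeff v ≠ 0)
    (h3 : 3 ≤ (univ.image fun γ : Γ => γ • x₀).card) :
    ¬ ∀ w : ℕ, (∑ s, ∏ x, W (τ s x) x).coeff w ≤ 2 := by
  intro h
  obtain ⟨w, hw⟩ := functorialLock W hW0 hWinv τ hτ s₀ x₀ huv hu hv h3
  have := h w
  omega

/-- Sharpness bookkeeping for the automorphic-induction transfer (`r = Ind`, the family
`τ = ` the `Γ`-translates of "`V` at `x₀`, trivial elsewhere"): one tuple with value polynomial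
`p₀` at `x₀` and the constant polynomial `1` elsewhere has product `p₀`; so the orbit contributes
exactly `|orbit| • p₀`, multiplicity `m` times that of `π` — the count of
`SoloBlindInducedMultiplicity`.  Recorded as the identity behind that remark. -/
theorem prod_update_one (p₀ : ℕ[X]) (x₀ : E) :
    ∏ x, Function.update (fun _ : E => (1 : ℕ[X])) x₀ p₀ x = p₀ := by
  rw [Finset.prod_update_of_mem (Finset.mem_univ x₀)]
  simp

end Lock

section NonVacuity

/-- Non-vacuity and sharpness test, in the automorphic-induction shape for `m = 3`
(`E = Fin 3` three embeddings permuted transitively by `Γ = Perm (Fin 3)`, `S = Fin 3` the three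
translates of "a two-exponent factor `1 + X` at position `s`, the trivial factor `1` elsewhere"):
every hypothesis of `functorialLock_of_transitive` is met, and the bound `3 = |E|` it returns is
attained (the total is `3 • (1 + X)`). -/
example : ∃ w : ℕ, 3 ≤ (∑ s : Fin 3, ∏ x : Fin 3, if x = s then (1 + X : ℕ[X]) else 1).coeff w := by
  obtain ⟨w, hw⟩ := functorialLock_of_transitive (Γ := Equiv.Perm (Fin 3))
    (fun (b : Bool) (_ : Fin 3) => if b then (1 + X : ℕ[X]) else 1)
    (by
      intro b x
      cases b
      · exact one_ne_zero
      · intro h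
        have h0 := congrArg (fun q : ℕ[X] => q.coeff 0) h
        simp at h0)
    (fun _ _ _ => rfl)
    (fun (s x : Fin 3) => decide (x = s))
    (by
      intro γ s
      refine ⟨γ⁻¹ • s, ?_⟩
      funext x
      simp only [Equiv.Perm.smul_def]
      by_cases h : γ x = s
      · have hx : x = γ.symm s := by rw [← h]; simp
        simp [hx]
      · have hx : x ≠ γ.symm s := by
          intro hx; apply h; rw [hx]; simp
        simp [h, hx])
    0 0 (fun x => ⟨Equiv.swap 0 x, by simp [Equiv.Perm.smul_def]⟩)
    (u := 0) (v := 1) zero_ne_one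
    (by simp [coeff_one, coeff_X])
    (by simp [coeff_one, coeff_X])
  exact ⟨w, by simpa using hw⟩

end NonVacuity

end Summit.Langlands.Langlands.Theorems.SoloBlind
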